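import Mathlib

/-!
# Route GirthSidon — crux `PolySwallowForcesShortRelation` (stmt-ValiantsHypothesis-6537), line
`two_ended_honesty`: RANK COUNT for born targets — a counterexample needs polynomially many
non-monomial sources

Setting of the totally-born residual (`stub_totallyBornTargets`, see
`Theorems/GirthSidonPolySwallowForcesShortRelationTotallyBorn.lean`): `W = span_K(1, y_1, …, y_s) ⊂ K[x]`,
targets `x^{d_i} = Γ_i(y) ∈ W·W`.  Split the sources into MONOMIAL ones (`y_j = c·x^{a_j}`, exponent set
`T ∋ 0`, `|T| ≤ k+1`) and the rest (`r` of them, spanning `N`).  Then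
`W·W ⊆ span(x^{T+T}) + (x^T·N + N·N)` and the second summand has dimension `≤ r(|T| + r)`.  Projecting onto
the coefficients OUTSIDE `T+T` kills the first summand and keeps distinct monomials independent, so

  `#{e : x^e ∈ W·W, e ∉ T+T} ≤ r·(|T| + r)`        (`card_born_le_rank`).

Totally-born targets avoid `T + T ⊆ (O₀ ∪ O_∞) + (O₀ ∪ O_∞)`, hence: if all `m` targets are born off
`T+T` and `r(|T|+r) < m`, two targets coincide and the relation `{i} ≠ {j}` exists
(`relation_of_few_nonMonomial_sources`).  With `s ≤ 1.87 m^{0.9}` this says a counterexample to the residual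
has `r ≳ m^{0.1}/3.8` genuinely non-monomial sources (each, by the sparse engine of item 6539, with many
terms).  Also recorded: the Γ-form ⇒ V-form bridge for polynomial algebras
(`aeval_mem_span_mul_of_totalDegree_le_two`, any commutative algebra).  VP ≠ VNP is not moved.
[folklore]
-/

set_option linter.dupNamespace false

namespace Summit.ValiantsHypothesis.ValiantsHypothesis.Theorems

open Polynomial
open scoped Pointwise

namespace PolySwallowBornRank

section Algebra

variable {K A : Type*} [Field K] [CommRing A] [Algebra K A]

/-- Products `∏_{j ∈ S} y_j^{e_j}` of total weight `≤ 2` of elements `y_j` of a subspace `V ∋ 1` of a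
commutative `K`-algebra lie in `span(V·V)` (induction on `S`, tracking weights `0`, `≤ 1`, `≤ 2`).
[folklore] -/
theorem prod_pow_mem_span_mul_of_sum_le_two {σ : Type*} (y : σ → A) (V : Submodule K A)
    (h1 : (1 : A) ∈ V) (hy : ∀ j, y j ∈ V) (e : σ → ℕ) (S : Finset σ) (hS : ∑ j ∈ S, e j ≤ 2) :
    (∏ j ∈ S, y j ^ e j) ∈ Submodule.span K ((V : Set A) * (V : Set A)) := by
  classical
  suffices H : (∑ j ∈ S, e j = 0 → ∏ j ∈ S, y j ^ e j = 1) ∧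
      (∑ j ∈ S, e j ≤ 1 → (∏ j ∈ S, y j ^ e j) ∈ V) ∧
      (∑ j ∈ S, e j ≤ 2 → (∏ j ∈ S, y j ^ e j) ∈ Submodule.span K ((V : Set A) * (V : Set A)))
    from H.2.2 hS
  clear hS
  induction S using Finset.induction_on with
  | empty =>
    refine ⟨fun _ => by simp, fun _ => by simpa using h1, fun _ => ?_⟩
    simpa using Submodule.subset_span (Set.mul_mem_mul h1 h1)
  | insert a S ha ih =>
    obtain ⟨ih0, ih1, ih2⟩ := ih
    rw [Finset.sum_insert ha, Finset.prod_insert ha]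
    refine ⟨fun h => ?_, fun h => ?_, fun h => ?_⟩
    · have hea : e a = 0 := by omega
      rw [hea, pow_zero, one_mul, ih0 (by omega)]
    · rcases Nat.lt_or_ge (e a) 1 with hlt | hge
      · have hea : e a = 0 := by omega
        rw [hea, pow_zero, one_mul]
        exact ih1 (by omega)
      · have hea : e a = 1 := by omega
        rw [hea, pow_one, ih0 (by omega), mul_one]
        exact hy a
    · rcases Nat.lt_or_ge (e a) 1 with hlt | hge
      · have hea : e a = 0 := by omega
        rw [hea, pow_zero, one_mul]
        exact ih2 (by omega)
      · rcases Nat.lt_or_ge (e a) 2 with hlt2 | hge2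
        · have hea : e a = 1 := by omega
          rw [hea, pow_one]
          exact Submodule.subset_span (Set.mul_mem_mul (hy a) (ih1 (by omega)))
        · have hea : e a = 2 := by omega
          rw [hea, ih0 (by omega), mul_one, pow_two]
          exact Submodule.subset_span (Set.mul_mem_mul (hy a) (hy a))

/-- **Γ-form ⇒ V-form.**  For `p` of total degree `≤ 2` and `y_j` in a subspace `V ∋ 1` of a commutative
`K`-algebra, `p(y) ∈ span(V·V)`. [folklore] -/
theorem aeval_mem_span_mul_of_totalDegree_le_two {σ : Type*} (y : σ → A) (V : Submodule K A)
    (h1 : (1 : A) ∈ V) (hy : ∀ j, y j ∈ V) (p : MvPolynomial σ K) (hp : p.totalDegree ≤ 2) :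
    MvPolynomial.aeval y p ∈ Submodule.span K ((V : Set A) * (V : Set A)) := by
  classical
  rw [p.as_sum, map_sum (MvPolynomial.aeval y)]
  refine Submodule.sum_mem _ fun d hd => ?_
  rw [MvPolynomial.aeval_monomial, ← Algebra.smul_def]
  refine Submodule.smul_mem _ _ ?_
  have hdeg : (d.sum fun _ e => e) ≤ 2 := le_trans (MvPolynomial.le_totalDegree hd) hp
  exact prod_pow_mem_span_mul_of_sum_le_two y V h1 hy d d.support hdeg

end Algebra

section Rank

variable {K : Type*} [Field K]

/-- The coefficient-extraction map onto a finite set `D` of exponents. -/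
theorem coeffPi_apply (D : Finset ℕ) (p : K[X]) (e : D) :
    (LinearMap.pi fun e : D => Polynomial.lcoeff K (e : ℕ)) p e = p.coeff e := rfl

/-- **Rank count for born monomials.**  Let `G = {x^a : a ∈ T} ∪ N ⊂ K[x]` and `V ≤ span G`.  Every
monomial `x^e ∈ span(V·V)` with `e ∉ T + T` is detected by the coefficient-extraction map
`L : K[x] → K^D` (`D` = such exponents), which kills `x^{T+T}` and maps `x^e` to the `e`-th basis vector;
since `span(V·V) ≤ span(x^{T+T}) + span(x^T·N ∪ N·x^T ∪ N·N)`, the basis vectors lie in the image of a space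
of dimension `≤ |T|·|N| + |N|·|T| + |N|²`, whence `|D| ≤ |N|·(2|T| + |N|)`. [folklore] -/
theorem card_born_le_rank (V : Submodule K K[X]) (T : Finset ℕ) (N : Finset K[X])
    (hV : V ≤ Submodule.span K (((fun a : ℕ => (X : K[X]) ^ a) '' (T : Set ℕ)) ∪ (N : Set K[X])))
    (D : Finset ℕ)
    (hD : ∀ e ∈ D, ((X : K[X]) ^ e) ∈ Submodule.span K ((V : Set K[X]) * (V : Set K[X])))
    (hborn : ∀ e ∈ D, ∀ a ∈ T, ∀ b ∈ T, e ≠ a + b) :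
    D.card ≤ N.card * (2 * T.card + N.card) := by
  classical
  -- generators
  set MT : Finset K[X] := T.image fun a => (X : K[X]) ^ a with hMT
  let G : Set K[X] := ((fun a : ℕ => (X : K[X]) ^ a) '' (T : Set ℕ)) ∪ (N : Set K[X])
  have hMTG : ∀ p, p ∈ G ↔ p ∈ MT ∨ p ∈ N := by
    intro p
    simp only [G, hMT, Set.mem_union, Set.mem_image, Finset.mem_coe, Finset.mem_image]
  -- the mixed/dense generator set
  let Q : Finset K[X] := ((MT ×ˢ N).image fun p => p.1 * p.2) ∪ ((N ×ˢ MT).image fun p => p.1 * p.2) ∪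
    ((N ×ˢ N).image fun p => p.1 * p.2)
  have hQcard : Q.card ≤ N.card * (2 * T.card + N.card) := by
    have hMTc : MT.card ≤ T.card := Finset.card_image_le
    calc Q.card ≤ ((MT ×ˢ N).image fun p => p.1 * p.2).card + ((N ×ˢ MT).image fun p => p.1 * p.2).card
          + ((N ×ˢ N).image fun p => p.1 * p.2).card :=
            le_trans (Finset.card_union_le _ _) (Nat.add_le_add_right (Finset.card_union_le _ _) _)
      _ ≤ (MT ×ˢ N).card + (N ×ˢ MT).card + (N ×ˢ N).card := by
            gcongr <;> exact Finset.card_image_le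
      _ = MT.card * N.card + N.card * MT.card + N.card * N.card := by
            simp only [Finset.card_product]
      _ ≤ T.card * N.card + N.card * T.card + N.card * N.card := by gcongr
      _ = N.card * (2 * T.card + N.card) := by ring
  -- span(V·V) ≤ span(MT·MT) ⊔ span Q
  have hVV : Submodule.span K ((V : Set K[X]) * (V : Set K[X])) ≤
      Submodule.span K ((MT : Set K[X]) * (MT : Set K[X])) ⊔ Submodule.span K (Q : Set K[X]) := by
    have h1 : Submodule.span K ((V : Set K[X]) * (V : Set K[X])) ≤ Submodule.span K (G * G) := by
      rw [← Submodule.span_mul_span, ← Submodule.span_mul_span, Submodule.span_eq]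
      exact mul_le_mul' hV hV
    refine le_trans h1 ?_
    rw [Submodule.span_le]
    rintro _ ⟨p, hp, q, hq, rfl⟩
    rw [hMTG] at hp hq
    rcases hp with hp | hp <;> rcases hq with hq | hq
    · exact Submodule.mem_sup_left (Submodule.subset_span (Set.mul_mem_mul hp hq))
    · refine Submodule.mem_sup_right (Submodule.subset_span ?_)
      simp only [Q, Finset.coe_union, Set.mem_union, Finset.mem_coe, Finset.mem_image,
        Finset.mem_product]
      exact Or.inl (Or.inl ⟨(p, q), ⟨hp, hq⟩, rfl⟩)
    · refine Submodule.mem_sup_right (Submodule.subset_span ?_)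
      simp only [Q, Finset.coe_union, Set.mem_union, Finset.mem_coe, Finset.mem_image,
        Finset.mem_product]
      exact Or.inl (Or.inr ⟨(p, q), ⟨hp, hq⟩, rfl⟩)
    · refine Submodule.mem_sup_right (Submodule.subset_span ?_)
      simp only [Q, Finset.coe_union, Set.mem_union, Finset.mem_coe, Finset.mem_image,
        Finset.mem_product]
      exact Or.inr ⟨(p, q), ⟨hp, hq⟩, rfl⟩
  -- the coefficient extraction map at the exponents of D
  let L : K[X] →ₗ[K] (D → K) := LinearMap.pi fun e : D => Polynomial.lcoeff K (e : ℕ)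
  have hLT : ∀ p ∈ Submodule.span K ((MT : Set K[X]) * (MT : Set K[X])), L p = 0 := by
    intro p hp
    refine Submodule.span_induction ?_ ?_ ?_ ?_ hp
    · rintro _ ⟨u, hu, v, hv, rfl⟩
      simp only [hMT, Finset.coe_image, Set.mem_image, Finset.mem_coe] at hu hv
      obtain ⟨a, ha, rfl⟩ := hu
      obtain ⟨b, hb, rfl⟩ := hv
      funext e
      show ((X : K[X]) ^ a * X ^ b).coeff (e : ℕ) = 0
      rw [← pow_add, Polynomial.coeff_X_pow, if_neg]
      exact hborn e e.2 a ha b hb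
    · exact map_zero L
    · intro p q _ _ hp hq; rw [map_add, hp, hq, add_zero]
    · intro c p _ hp; rw [map_smul, hp, smul_zero]
  -- every basis vector of `D → K` is hit by `L` on `span Q`
  have htop : (⊤ : Submodule K (D → K)) ≤ (Submodule.span K (Q : Set K[X])).map L := by
    rw [← (Pi.basisFun K D).span_eq, Submodule.span_le]
    rintro _ ⟨e, rfl⟩
    have hXe : ((X : K[X]) ^ (e : ℕ)) ∈ Submodule.span K ((MT : Set K[X]) * (MT : Set K[X])) ⊔
        Submodule.span K (Q : Set K[X]) := hVV (hD e e.2)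
    obtain ⟨p, hp, q, hq, hpq⟩ := Submodule.mem_sup.mp hXe
    refine ⟨q, hq, ?_⟩
    have hLX : L ((X : K[X]) ^ (e : ℕ)) = Pi.basisFun K D e := by
      funext e'
      rw [coeffPi_apply, Polynomial.coeff_X_pow, Pi.basisFun_apply, Pi.single_apply]
      by_cases h : e' = e
      · subst h; simp
      · have h' : (e' : ℕ) ≠ e := fun hh => h (Subtype.ext hh)
        rw [if_neg h', if_neg h]
    rw [← hLX, ← hpq, map_add, hLT p hp, zero_add]
  -- dimension count
  have hfin : Module.finrank K (D → K) = D.card := by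
    rw [Module.finrank_fintype_fun_eq_card, Fintype.card_coe]
  calc D.card = Module.finrank K (⊤ : Submodule K (D → K)) := by rw [finrank_top, hfin]
    _ ≤ Module.finrank K ((Submodule.span K (Q : Set K[X])).map L) := Submodule.finrank_mono htop
    _ ≤ Module.finrank K (Submodule.span K (Q : Set K[X])) := Submodule.finrank_map_le L _
    _ ≤ Q.card := finrank_span_finset_le_card Q
    _ ≤ N.card * (2 * T.card + N.card) := hQcard

end Rank

/-- **Sub-regime of the totally-born residual: few non-monomial sources.**  Quadratic polynomial
swallowing `Γ_i(y) = x^{d_i}` with sources split by `J`: for `j ∈ J`, `y_j = c_j · x^{a_j}` is a monomial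
(exponent set `T = {0} ∪ a(J)`), the other `r` sources arbitrary, `s ≤ |J| + r`.  If every target avoids
`T + T` (in particular if it is totally born: `T ⊆ O₀ ∩ O_∞`) and `r·(2(s+1) + r) < m`, then a relation of
length `≤ 30` exists — indeed two targets coincide, by `card_born_le_rank`.  Consequently a counterexample to
`stub_totallyBornTargets` at `s ≤ 1.87·m^{0.9}` has `r ≳ m^{0.1}/4` non-monomial sources. [folklore] -/
theorem relation_of_few_nonMonomial_sources {m s r : ℕ} (d : Fin m → ℕ)
    (Γ : Fin m → MvPolynomial (Fin s) ℂ) (y : Fin s → Polynomial ℂ)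
    (hΓ : ∀ i, (Γ i).totalDegree ≤ 2) (hy : ∀ i, MvPolynomial.aeval y (Γ i) = Polynomial.X ^ d i)
    (J : Finset (Fin s)) (a : Fin s → ℕ) (c : Fin s → ℂ)
    (hJ : ∀ j ∈ J, y j = Polynomial.C (c j) * Polynomial.X ^ (a j)) (hr : s ≤ J.card + r)
    (hborn : ∀ i, ∀ u ∈ insert 0 (J.image a), ∀ v ∈ insert 0 (J.image a), d i ≠ u + v)
    (hm : r * (2 * (s + 1) + r) < m) :
    ∃ S T : Multiset (Fin m), S ≠ T ∧ Multiset.card S ≤ 30 ∧ Multiset.card T ≤ 30 ∧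
      (S.map d).sum = (T.map d).sum := by
  classical
  -- two targets coincide
  suffices hni : ¬ Function.Injective d by
    obtain ⟨i, j, hij, hne⟩ : ∃ i j, d i = d j ∧ i ≠ j := by
      simpa [Function.Injective] using hni
    exact ⟨{i}, {j}, by simpa using hne, by simp, by simp, by simpa using hij⟩
  intro hinj
  let V : Submodule ℂ ℂ[X] := Submodule.span ℂ (insert 1 (Set.range y))
  let T : Finset ℕ := insert 0 (J.image a)
  let N : Finset ℂ[X] := (Finset.univ.filter fun j => j ∉ J).image y
  have hTcard : T.card ≤ J.card + 1 :=
    le_trans (Finset.card_insert_le _ _) (by simpa using Finset.card_image_le (s := J) (f := a))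
  have hNcard : N.card ≤ r := by
    refine le_trans Finset.card_image_le ?_
    have h := Finset.card_filter_add_card_filter_not (s := (Finset.univ : Finset (Fin s)))
      (fun j : Fin s => j ∈ J)
    simp only [Finset.filter_mem_eq_inter, Finset.univ_inter, Finset.card_univ,
      Fintype.card_fin] at h
    omega
  -- V ≤ span (x^T ∪ N)
  have hJs : J.card ≤ s := by simpa using J.card_le_univ
  have hV : V ≤ Submodule.span ℂ (((fun a : ℕ => (X : ℂ[X]) ^ a) '' (T : Set ℕ)) ∪ (N : Set ℂ[X])) := by
    rw [Submodule.span_le]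
    rintro p hp
    rcases Set.mem_insert_iff.mp hp with rfl | ⟨j, rfl⟩
    · refine Submodule.subset_span (Set.mem_union_left _ ⟨0, ?_, by simp⟩)
      exact Finset.mem_coe.mpr (Finset.mem_insert_self _ _)
    · by_cases hj : j ∈ J
      · rw [hJ j hj, ← Polynomial.smul_eq_C_mul]
        refine Submodule.smul_mem _ _ (Submodule.subset_span (Set.mem_union_left _ ⟨a j, ?_, rfl⟩))
        exact Finset.mem_coe.mpr (Finset.mem_insert_of_mem (Finset.mem_image.mpr ⟨j, hj, rfl⟩))
      · refine Submodule.subset_span (Set.mem_union_right _ (Finset.mem_coe.mpr ?_))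
        exact Finset.mem_image.mpr ⟨j, Finset.mem_filter.mpr ⟨Finset.mem_univ _, hj⟩, rfl⟩
  -- the targets as a finset of exponents
  let D : Finset ℕ := Finset.univ.image d
  have hDcard : D.card = m := by
    rw [Finset.card_image_of_injective _ hinj, Finset.card_univ, Fintype.card_fin]
  have h1V : (1 : ℂ[X]) ∈ V := Submodule.subset_span (Set.mem_insert _ _)
  have hyV : ∀ j, y j ∈ V := fun j => Submodule.subset_span (Set.mem_insert_of_mem _ ⟨j, rfl⟩)
  have hD : ∀ e ∈ D, ((X : ℂ[X]) ^ e) ∈ Submodule.span ℂ ((V : Set ℂ[X]) * (V : Set ℂ[X])) := by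
    intro e he
    obtain ⟨i, -, rfl⟩ := Finset.mem_image.mp he
    rw [← hy i]
    exact aeval_mem_span_mul_of_totalDegree_le_two y V h1V hyV (Γ i) (hΓ i)
  have hbornD : ∀ e ∈ D, ∀ u ∈ T, ∀ v ∈ T, e ≠ u + v := by
    intro e he u hu v hv
    obtain ⟨i, -, rfl⟩ := Finset.mem_image.mp he
    exact hborn i u hu v hv
  have hle := card_born_le_rank V T N hV D hD hbornD
  have : m ≤ r * (2 * (s + 1) + r) := by
    rw [← hDcard]
    refine le_trans hle ?_
    calc N.card * (2 * T.card + N.card) ≤ r * (2 * (J.card + 1) + r) := by gcongr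
      _ ≤ r * (2 * (s + 1) + r) := by gcongr
  omega

end PolySwallowBornRank

end Summit.ValiantsHypothesis.ValiantsHypothesis.Theorems
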